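/-
Copyright: the b2b-balaban T⁴-continuum CRUX team, row NE7b OWNER lineage `t4-ne7b-p1` (gen 128). Project licence.
-/
import Summits.QuantumFields.BalabanUV.T4Continuum.Spine.NE7b.SupRegulatorRenormalised
import Summits.QuantumFields.BalabanUV.T4Continuum.Spine.NE7b.SupRegulatedActivityBound

/-!
# THE SHIFTED ACTIVITIES WITH THE EXACT REGULATOR: for regulated cell factors `‖g_p(ω)‖ ≤ ε·e^{½κΣ_{x∈cell p}ω_x²}` over `N(0,Γ)`
# (`Γ ⪯ γ_op·1`, diagonal `≤ γ`, disjoint cells of `≤ v` sites, `κγ_op ≤ θ < 1`) and EVERY external field `ψ`, the shifted activity obeys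
# `‖∫∏_{p∈K} g_p(ω+ψ) dN(0,Γ)(ω)‖ ≤ (ε·A^v)^{#K} · e^{½κ(1−θ)⁻¹Σ_{x∈⋃_{p∈K}cell p}ψ_x²}`, `A = (1−θ)^{−κγ∕(2θ)}` — the SAME `ε, κ, A` as the
# unshifted bound of (289), the external-field regulator on the polymer's own cells at strength `κ∕(1−θ)` (no Young loss): (295)'s
# renormalised-regulator bound applied to the product functional of (289) (row NE7b, node U5c; (295) + (289) BY NAME; [folklore])

Cell `pub-balaban`, sub-cell `t4`, spine estimate NE7b (`T4WeightBudget.RelWeightBound`; the cell's OWN estimate — NOT PRINTED in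
[Bałaban 1983–89], NOT PROVED).  Crux-route work under `Spine/NE7b/` by the row OWNER (`t4-ne7b-p1` gen 128, file (299)) under FREEZE
(0)'s crux-prover clause, on § [NE7bP1-G127-HANDOFF] NEXT (3)(b)∕(e); NOTHING of Bałaban's is named as a Lean object, valued or asserted; no
`T4Continuum/Support` leaf typed; no `def`, no notation; zero `sorry`.  Imports (BY NAME): the OWNER's (295) `…SupRegulatorRenormalised`
(`regulated_convolution_on_le`), (289) `…SupRegulatedActivityBound` (`norm_prod_le_regulator`, `card_biUnion_cell_le`, `one_le_regulatorCost`).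

WHY (located).  (292) typed the shifted activity bound with Young's inequality (fluctuation strength `κ(1+τ)`, external strength
`κ(1+τ⁻¹)`); (295) typed the exact renormalised regulator `M(1−ΓM)⁻¹ ⪯ (1−θ)⁻¹M`.  Reading (295) on the product functional
`K(x) = ∏_{p∈K} g_p(x)` — regulated by `ε^{#K}e^{½κΣ_{⋃K}x²}` by (289) §1 — gives the shifted activity bound with NO loss in the fluctuation
strength and external strength `κ∕(1−θ)`: the form in which the activities are handed to the next scale.

WHAT IS PROVED ([folklore]):
* §1 **`shifted_norm_cellActivity_le_exact`** (the displayed bound, for every `ψ` and every finite `K`; no measurability needed);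
* §2 `shifted_norm_cellActivity_le_exact_of_small` (external field small on the cells of `K`: `Σ_{cell p}ψ² ≤ Ψ²` for `p ∈ K` ⟹
  `≤ (ε·A^v·e^{½κ(1−θ)⁻¹Ψ²})^{#K}` — the constant form consumed by (287)∕(296)); §3 toy.

HONEST (what this is NOT).  A corollary of (295) on (289)'s product bound; one scale; scalar skeleton ((A3), NC-NE7b-α UNRULED); nothing
of Bałaban's asserted.  BY-NAME EFFECT ON THE WALL: NONE.  NE7b NOT PRINTED ∕ NOT PROVED; spine PROVED 0∕9; rung (B)+1 — the programme's measures
remain FINITE-torus statements; NOT the mass gap, NOT Clay.  HONEST DEPENDENCY: continuum YM on T⁴ ⇐ BetaPertH ∧ nine spine estimates (0∕9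
proved); BetaPertH ⇐ (D1) ∧ (D4) ∧ CAP+tail; G-an2-4 gates asym, D1 and NE2∕3∕4.
-/

set_option autoImplicit false

noncomputable section

namespace Summit.QuantumFields.BalabanUV.T4Continuum.NE7b.SupShiftedActivityExact

open MeasureTheory ProbabilityTheory Finset Real WithLp
open scoped BigOperators
open Literature.Probability.LatticeModels (cellActivity)
open SupRegulatorRenormalised (regulated_convolution_on_le)
open SupRegulatedActivityBound (norm_prod_le_regulator card_biUnion_cell_le one_le_regulatorCost)

variable {ι : Type} [Fintype ι] [DecidableEq ι] {V : Type*}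

/-! ## §1. The shifted activity bound with the exact regulator -/

/-- **THE SHIFTED ACTIVITY BOUND, EXACT REGULATOR.**  `Γ ⪰ 0`, `Γ ⪯ γ_op·1` (`γ_op ≥ 0`), `Γ(x,x) ≤ γ` for all `x` (`γ ≥ 0`); pairwise
disjoint cells of `≤ v` sites; `‖g_p(ω)‖ ≤ ε·e^{½κΣ_{x∈cell p}ω_x²}` (`0 ≤ ε`, `0 ≤ κ`, `0 < θ < 1`, `κγ_op ≤ θ`) ⟹ for EVERY external field
`ψ` and every finite `K`: `‖∫∏_{p∈K} g_p(ω + ψ) dN(0,Γ)(ω)‖ ≤ (ε·A^v)^{#K}·e^{½κ(1−θ)⁻¹Σ_{x∈⋃_{p∈K}cell p}ψ_x²}`, `A = (1−θ)^{−κγ∕(2θ)}`.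
[folklore] -/
theorem shifted_norm_cellActivity_le_exact [DecidableEq V] {Γ : Matrix ι ι ℝ} {γop γ : ℝ} (hΓ : Γ.PosSemidef)
    (hΓop : (γop • (1 : Matrix ι ι ℝ) - Γ).PosSemidef) (hγop : 0 ≤ γop) (hdiag : ∀ i, Γ i i ≤ γ) (hγ : 0 ≤ γ)
    (cell : V → Finset ι) (hdisj : ∀ p q, p ≠ q → Disjoint (cell p) (cell q)) {v : ℕ} (hv : ∀ p, (cell p).card ≤ v)
    {g : V → EuclideanSpace ℝ ι → ℂ} {ε κ θ : ℝ} (hε : 0 ≤ ε) (hκ : 0 ≤ κ) (hθ0 : 0 < θ) (hθ1 : θ < 1) (hκθ : κ * γop ≤ θ)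
    (hreg : ∀ p ω, ‖g p ω‖ ≤ ε * exp (κ * (∑ x ∈ cell p, ω x ^ 2) / 2)) (ψ : EuclideanSpace ℝ ι) (K : Finset V) :
    ‖cellActivity (multivariateGaussian 0 Γ) (fun p ω => g p (ω + ψ)) K‖ ≤
      (ε * ((1 - θ) ^ (-(κ * γ / (2 * θ)))) ^ v) ^ K.card *
        exp (κ * (1 - θ)⁻¹ * (∑ x ∈ K.biUnion cell, ψ x ^ 2) / 2) := by
  set A : ℝ := (1 - θ) ^ (-(κ * γ / (2 * θ))) with hA
  have hA1 : 1 ≤ A := one_le_regulatorCost (mul_nonneg hκ hγ) hθ0 hθ1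
  -- the product functional on `ℝ^ι` is regulated on `⋃K` with constant `ε^{#K}` ((289) §1, read on plain functions)
  have hK : ∀ x : ι → ℝ, ‖∏ p ∈ K, g p (toLp 2 x)‖ ≤ ε ^ K.card * exp (κ * (∑ i ∈ K.biUnion cell, x i ^ 2) / 2) := fun x => by
    simpa using norm_prod_le_regulator cell hdisj hreg K (toLp 2 x)
  have h := regulated_convolution_on_le (E := ℂ) hΓ hΓop hγop hκ hθ0 hθ1 hκθ (pow_nonneg hε _) (K.biUnion cell) (fun i _ => hdiag i) hK
    (ofLp ψ)
  -- identify the integrand: `toLp (ofLp ω + ofLp ψ) = ω + ψ`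
  have hint : (∫ x, ∏ p ∈ K, g p (toLp 2 (ofLp x + ofLp ψ)) ∂(multivariateGaussian 0 Γ)) =
      cellActivity (multivariateGaussian 0 Γ) (fun p ω => g p (ω + ψ)) K := by
    unfold cellActivity
    refine integral_congr_ae (ae_of_all _ fun x => ?_)
    show ∏ p ∈ K, g p (toLp 2 (ofLp x + ofLp ψ)) = ∏ p ∈ K, g p (x + ψ)
    rw [← WithLp.ofLp_add, WithLp.toLp_ofLp]
  rw [hint] at h
  refine h.trans ?_
  -- `A^{#⋃K} ≤ A^{v#K}` and collect
  have hpow : A ^ (K.biUnion cell).card ≤ A ^ (v * K.card) := pow_le_pow_right₀ hA1 (card_biUnion_cell_le cell hv K)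
  have hψ : (∑ i ∈ K.biUnion cell, (ofLp ψ) i ^ 2) = ∑ x ∈ K.biUnion cell, ψ x ^ 2 := rfl
  rw [hψ]
  calc ε ^ K.card * A ^ (K.biUnion cell).card * exp (κ * (1 - θ)⁻¹ * (∑ x ∈ K.biUnion cell, ψ x ^ 2) / 2)
      ≤ ε ^ K.card * A ^ (v * K.card) * exp (κ * (1 - θ)⁻¹ * (∑ x ∈ K.biUnion cell, ψ x ^ 2) / 2) :=
        mul_le_mul_of_nonneg_right (mul_le_mul_of_nonneg_left hpow (pow_nonneg hε _)) (exp_pos _).le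
    _ = (ε * A ^ v) ^ K.card * exp (κ * (1 - θ)⁻¹ * (∑ x ∈ K.biUnion cell, ψ x ^ 2) / 2) := by
        rw [mul_pow, ← pow_mul]

/-! ## §2. The constant form on a small-field region -/

omit [Fintype ι] in
/-- On cells where the external field is small the cell regulator in `ψ` is a constant: `Σ_{x∈cell p}ψ_x² ≤ Ψ²` for `p ∈ K` ⟹
`e^{½κ′Σ_{x∈⋃K}ψ_x²} ≤ (e^{½κ′Ψ²})^{#K}` (`κ′ ≥ 0`, disjoint cells). [folklore] -/
theorem exp_sum_biUnion_le [DecidableEq V] (cell : V → Finset ι) (hdisj : ∀ p q, p ≠ q → Disjoint (cell p) (cell q)) {κ' Ψ : ℝ}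
    (hκ' : 0 ≤ κ') (ψ : EuclideanSpace ℝ ι) (K : Finset V) (hψ : ∀ p ∈ K, ∑ x ∈ cell p, ψ x ^ 2 ≤ Ψ ^ 2) :
    exp (κ' * (∑ x ∈ K.biUnion cell, ψ x ^ 2) / 2) ≤ exp (κ' * Ψ ^ 2 / 2) ^ K.card := by
  have hpd : (K : Set V).PairwiseDisjoint cell := fun p _ q _ hpq => hdisj p q hpq
  rw [← Real.exp_nat_mul, sum_biUnion hpd]
  refine exp_le_exp.2 ?_
  have hsum : ∑ p ∈ K, ∑ x ∈ cell p, ψ x ^ 2 ≤ K.card * Ψ ^ 2 := by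
    calc ∑ p ∈ K, ∑ x ∈ cell p, ψ x ^ 2 ≤ ∑ _p ∈ K, Ψ ^ 2 := sum_le_sum hψ
      _ = K.card * Ψ ^ 2 := by rw [sum_const, nsmul_eq_mul]
  have := mul_le_mul_of_nonneg_left hsum hκ'
  nlinarith [this]

/-- **THE CONSTANT FORM**: under the hypotheses of `shifted_norm_cellActivity_le_exact`, if `Σ_{x∈cell p}ψ_x² ≤ Ψ²` for the cells `p ∈ K`,
then `‖∫∏_{p∈K} g_p(ω+ψ) dN(0,Γ)‖ ≤ (ε·A^v·e^{½κ(1−θ)⁻¹Ψ²})^{#K}` — the activity bound of (287) with `ε_Ψ = εA^ve^{½κ(1−θ)⁻¹Ψ²}`. [folklore] -/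
theorem shifted_norm_cellActivity_le_exact_of_small [DecidableEq V] {Γ : Matrix ι ι ℝ} {γop γ : ℝ} (hΓ : Γ.PosSemidef)
    (hΓop : (γop • (1 : Matrix ι ι ℝ) - Γ).PosSemidef) (hγop : 0 ≤ γop) (hdiag : ∀ i, Γ i i ≤ γ) (hγ : 0 ≤ γ)
    (cell : V → Finset ι) (hdisj : ∀ p q, p ≠ q → Disjoint (cell p) (cell q)) {v : ℕ} (hv : ∀ p, (cell p).card ≤ v)
    {g : V → EuclideanSpace ℝ ι → ℂ} {ε κ θ Ψ : ℝ} (hε : 0 ≤ ε) (hκ : 0 ≤ κ) (hθ0 : 0 < θ) (hθ1 : θ < 1) (hκθ : κ * γop ≤ θ)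
    (hreg : ∀ p ω, ‖g p ω‖ ≤ ε * exp (κ * (∑ x ∈ cell p, ω x ^ 2) / 2)) (ψ : EuclideanSpace ℝ ι) (K : Finset V)
    (hψ : ∀ p ∈ K, ∑ x ∈ cell p, ψ x ^ 2 ≤ Ψ ^ 2) :
    ‖cellActivity (multivariateGaussian 0 Γ) (fun p ω => g p (ω + ψ)) K‖ ≤
      (ε * ((1 - θ) ^ (-(κ * γ / (2 * θ)))) ^ v * exp (κ * (1 - θ)⁻¹ * Ψ ^ 2 / 2)) ^ K.card := by
  have h := shifted_norm_cellActivity_le_exact hΓ hΓop hγop hdiag hγ cell hdisj hv hε hκ hθ0 hθ1 hκθ hreg ψ K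
  have hκ' : 0 ≤ κ * (1 - θ)⁻¹ := mul_nonneg hκ (inv_nonneg.2 (by linarith))
  have he := exp_sum_biUnion_le cell hdisj hκ' ψ K hψ
  have h0 : 0 ≤ (ε * ((1 - θ) ^ (-(κ * γ / (2 * θ)))) ^ v) ^ K.card :=
    pow_nonneg (mul_nonneg hε (pow_nonneg (zero_le_one.trans (one_le_regulatorCost (mul_nonneg hκ hγ) hθ0 hθ1)) _)) _
  calc ‖cellActivity (multivariateGaussian 0 Γ) (fun p ω => g p (ω + ψ)) K‖
      ≤ (ε * ((1 - θ) ^ (-(κ * γ / (2 * θ)))) ^ v) ^ K.card * exp (κ * (1 - θ)⁻¹ * (∑ x ∈ K.biUnion cell, ψ x ^ 2) / 2) := h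
    _ ≤ (ε * ((1 - θ) ^ (-(κ * γ / (2 * θ)))) ^ v) ^ K.card * exp (κ * (1 - θ)⁻¹ * Ψ ^ 2 / 2) ^ K.card :=
        mul_le_mul_of_nonneg_left he h0
    _ = _ := by rw [← mul_pow]

/-! ## §3. Toy -/

/-- Toy (§2): one cell, `Σ_{cell}ψ² ≤ Ψ²` ⟹ `e^{½κ′Σψ²} ≤ (e^{½κ′Ψ²})^1`. -/
example (cell : Unit → Finset (Fin 2)) (κ' Ψ : ℝ) (hκ' : 0 ≤ κ') (ψ : EuclideanSpace ℝ (Fin 2))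
    (hψ : ∀ p ∈ ({()} : Finset Unit), ∑ x ∈ cell p, ψ x ^ 2 ≤ Ψ ^ 2) :
    exp (κ' * (∑ x ∈ ({()} : Finset Unit).biUnion cell, ψ x ^ 2) / 2) ≤ exp (κ' * Ψ ^ 2 / 2) ^ ({()} : Finset Unit).card :=
  exp_sum_biUnion_le cell (fun p q hpq => absurd (Subsingleton.elim p q) hpq) hκ' ψ {()} hψ

end Summit.QuantumFields.BalabanUV.T4Continuum.NE7b.SupShiftedActivityExact
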